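import Mathlib
import Literature.NumberTheory.Transcendental.KZCalculusProofs
import Literature.NumberTheory.Transcendental.KZLogCalculusProofs
import Literature.NumberTheory.Transcendental.KZSubcalculusInvariants

/-!
# `OffTetraSectorKernel`, line `odd-hyperbolic-ladder`: the duplication formula of the real
dilogarithm inside the calculus (stub `stub_dilogDuplication`)

Stub `stub_dilogDuplication` of the crux `OffTetraSectorKernel` (stmt-KontsevichZagierPeriods-10557,
route HyperbolicBloch). For real-algebraic `0 < x < 1` write `Li₂(a) = ∬_{0<v<u<a} du dv/(u(1−v))`
and `−Li₂(−x) = ∬_{0<v<u<x} du dv/(u(1+v))`. The duplication formula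
`Li₂(x²) = 2 Li₂(x) + 2 Li₂(−x)` holds INSIDE the Kontsevich–Zagier calculus of moves:

* rule (2): the squaring map `Φ(a, b) = (a², b²)` is a polynomial (hence `ℚ`-semialgebraic) map,
  injective on the triangle `T = {0 < b < a < x}` with derivative `diag(2a, 2b)` (`|det| = 4ab`),
  and it maps `T` onto `{0 < v < u < x²}` (preimage point `(√u, √v)`); it pulls `du dv/(u(1−v))`
  back to `4ab/(a²(1−b²)) = 4b/(a(1−b²))`, so with the auxiliary representation
  `R = [T, 2/(a(1−b)) − 2/(a(1+b))]` the difference `[R] − [Li₂(x²)]` is ONE change-of-variables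
  move;
* rule (1b): `2/(a(1−b)) − 2/(a(1+b))` is the integrand of `R`, so
  `[T, 2/(a(1−b))] − [R] − [T, 2/(a(1+b))]` is ONE integrand-additivity move, and
  `[T, 2 f] − 2•[T, f]` is integrand additivity
  (`KZ.IntegralRep.of_constMul_nat_sub_nsmul_mem_relations`).

References: M. Kontsevich, D. Zagier, *Periods* (2001), §1.2 rules (1), (2); J. Bochnak, M. Coste,
M.-F. Roy, *Real Algebraic Geometry* (1998), §2.2.
-/

noncomputable section

open Set MeasureTheory MvPolynomial
open Literature.NumberTheory.Transcendental Literature.ModelTheory.ExponentialFields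

namespace Summit.KontsevichZagierPeriods.HyperbolicBloch.OffTetraSectorKernel

/-! ### The squaring map `Φ(a, b) = (a², b²)` -/

/-- The coordinates of the squaring map `Φ(a, b) = (a², b²)`. [folklore] -/
theorem dilogDup_sqMap_apply (Φ : (Fin 2 → ℝ) → (Fin 2 → ℝ))
    (hΦ : ∀ p, Φ p = ![p 0 ^ 2, p 1 ^ 2]) (p : Fin 2 → ℝ) :
    Φ p 0 = p 0 ^ 2 ∧ Φ p 1 = p 1 ^ 2 := by
  rw [hΦ]
  exact ⟨rfl, rfl⟩

/-- The squaring map is injective on the triangle `{0 < b < a < x}` (both coordinates are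
positive there). [folklore] -/
theorem dilogDup_sqMap_injOn (Φ : (Fin 2 → ℝ) → (Fin 2 → ℝ))
    (hΦ : ∀ p, Φ p = ![p 0 ^ 2, p 1 ^ 2]) (x : ℝ) :
    InjOn Φ {p : Fin 2 → ℝ | 0 < p 1 ∧ p 1 < p 0 ∧ p 0 < x} := by
  intro p hp q hq hpq
  obtain ⟨hp1, hp2, -⟩ := hp
  obtain ⟨hq1, hq2, -⟩ := hq
  have h0 : p 0 ^ 2 = q 0 ^ 2 := by
    rw [← (dilogDup_sqMap_apply Φ hΦ p).1, ← (dilogDup_sqMap_apply Φ hΦ q).1, hpq]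
  have h1 : p 1 ^ 2 = q 1 ^ 2 := by
    rw [← (dilogDup_sqMap_apply Φ hΦ p).2, ← (dilogDup_sqMap_apply Φ hΦ q).2, hpq]
  funext i
  fin_cases i
  · exact (sq_eq_sq₀ (hp1.trans hp2).le (hq1.trans hq2).le).1 h0
  · exact (sq_eq_sq₀ hp1.le hq1.le).1 h1

/-- The squaring map is a `ℚ`-semialgebraic map on every `ℚ`-semialgebraic set: its coordinates
are the polynomials `X₀²`, `X₁²`. [cite: BochnakCosteRoy1998, §2.2] -/
theorem dilogDup_sqMap_isSemialgebraicMapOn (Φ : (Fin 2 → ℝ) → (Fin 2 → ℝ))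
    (hΦ : ∀ p, Φ p = ![p 0 ^ 2, p 1 ^ 2]) {σ : Set (Fin 2 → ℝ)} (hσ : IsSemialgebraic ℚ σ) :
    IsSemialgebraicMapOn ℚ σ Φ := by
  refine IsSemialgebraicMapOn.of_forall hσ fun j => ?_
  fin_cases j
  · exact (isSemialgebraicFunOn_aeval hσ (X 0 ^ 2)).congr fun p _ => by
      simp [(dilogDup_sqMap_apply Φ hΦ p).1]
  · exact (isSemialgebraicFunOn_aeval hσ (X 1 ^ 2)).congr fun p _ => by
      simp [(dilogDup_sqMap_apply Φ hΦ p).2]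

/-- **The image of the triangle under the squaring map**: for `0 < x`,
`Φ '' {0 < b < a < x} = {0 < v < u < x²}`; the preimage of `(u, v)` is `(√u, √v)`. [folklore] -/
theorem dilogDup_sqMap_image (Φ : (Fin 2 → ℝ) → (Fin 2 → ℝ))
    (hΦ : ∀ p, Φ p = ![p 0 ^ 2, p 1 ^ 2]) {x : ℝ} (hx : 0 < x) :
    Φ '' {p : Fin 2 → ℝ | 0 < p 1 ∧ p 1 < p 0 ∧ p 0 < x} =
      {q : Fin 2 → ℝ | 0 < q 1 ∧ q 1 < q 0 ∧ q 0 < x ^ 2} := by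
  ext q
  constructor
  · rintro ⟨p, ⟨h1, h2, h3⟩, rfl⟩
    obtain ⟨e0, e1⟩ := dilogDup_sqMap_apply Φ hΦ p
    simp only [mem_setOf_eq, e0, e1]
    exact ⟨pow_pos h1 2, pow_lt_pow_left₀ h2 h1.le two_ne_zero,
      pow_lt_pow_left₀ h3 (h1.trans h2).le two_ne_zero⟩
  · rintro ⟨h1, h2, h3⟩
    refine ⟨![Real.sqrt (q 0), Real.sqrt (q 1)], ?_, ?_⟩
    · simp only [mem_setOf_eq, Matrix.cons_val_zero, Matrix.cons_val_one]
      exact ⟨Real.sqrt_pos.2 h1, Real.sqrt_lt_sqrt h1.le h2, (Real.sqrt_lt' hx).2 h3⟩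
    · obtain ⟨e0, e1⟩ := dilogDup_sqMap_apply Φ hΦ ![Real.sqrt (q 0), Real.sqrt (q 1)]
      funext i
      fin_cases i
      · simpa [Real.sq_sqrt (h1.trans h2).le] using e0
      · simpa [Real.sq_sqrt h1.le] using e1

/-- **The derivative of the squaring map and its determinant.** At every point `p`, `Φ` has the
Fréchet derivative of matrix `diag(2 p₀, 2 p₁)`, of determinant `4 p₀ p₁`. [folklore] -/
theorem dilogDup_sqMap_hasFDerivAt_det (Φ : (Fin 2 → ℝ) → (Fin 2 → ℝ))
    (hΦ : ∀ p, Φ p = ![p 0 ^ 2, p 1 ^ 2]) (p : Fin 2 → ℝ) :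
    ∃ L : (Fin 2 → ℝ) →L[ℝ] (Fin 2 → ℝ), HasFDerivAt Φ L p ∧ L.det = 4 * p 0 * p 1 := by
  set M : Matrix (Fin 2) (Fin 2) ℝ := !![2 * p 0, 0; 0, 2 * p 1] with hM
  refine ⟨LinearMap.toContinuousLinearMap (Matrix.toLin' M), ?_, ?_⟩
  · -- derivative, componentwise
    have h0 : HasFDerivAt (fun x => Φ x 0)
        ((ContinuousLinearMap.proj 0).comp
          (LinearMap.toContinuousLinearMap (Matrix.toLin' M))) p := by
      have hf : (fun x => Φ x 0) = (fun y : ℝ => y ^ 2) ∘ fun x : Fin 2 → ℝ => x 0 := by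
        funext x
        exact (dilogDup_sqMap_apply Φ hΦ x).1
      rw [hf]
      refine ((hasDerivAt_pow 2 (p 0)).comp_hasFDerivAt p
        (hasFDerivAt_apply (𝕜 := ℝ) (0 : Fin 2) p)).congr_fderiv ?_
      ext v
      simp [hM, Matrix.toLin'_apply, dotProduct, Fin.sum_univ_two]
    have h1 : HasFDerivAt (fun x => Φ x 1)
        ((ContinuousLinearMap.proj 1).comp
          (LinearMap.toContinuousLinearMap (Matrix.toLin' M))) p := by
      have hf : (fun x => Φ x 1) = (fun y : ℝ => y ^ 2) ∘ fun x : Fin 2 → ℝ => x 1 := by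
        funext x
        exact (dilogDup_sqMap_apply Φ hΦ x).2
      rw [hf]
      refine ((hasDerivAt_pow 2 (p 1)).comp_hasFDerivAt p
        (hasFDerivAt_apply (𝕜 := ℝ) (1 : Fin 2) p)).congr_fderiv ?_
      ext v
      simp [hM, Matrix.toLin'_apply, dotProduct, Fin.sum_univ_two]
    refine hasFDerivAt_pi'' fun i => ?_
    fin_cases i
    exacts [h0, h1]
  · -- determinant
    rw [LinearMap.det_toContinuousLinearMap, LinearMap.det_toLin', hM, Matrix.det_fin_two_of]
    ring

/-! ### The two pointwise identities on the triangle -/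

/-- The Jacobian identity behind rule (2) on the triangle (`0 < a`, `0 < b < 1`):
`2/(a(1−b)) − 2/(a(1+b)) = [1/(u(1−v))](a², b²) · 4ab`. [folklore] -/
theorem dilogDup_jacobian_identity {a b : ℝ} (ha : 0 < a) (hb0 : 0 < b) (hb1 : b < 1) :
    2 * (1 / (a * (1 - b))) - 2 * (1 / (a * (1 + b))) =
      1 / (a ^ 2 * (1 - b ^ 2)) * (4 * a * b) := by
  have h1 : (1 - b) ≠ 0 := by linarith
  have h2 : (1 + b) ≠ 0 := by linarith
  have h3 : (1 - b ^ 2) ≠ 0 := by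
    rw [show (1 : ℝ) - b ^ 2 = (1 - b) * (1 + b) by ring]
    exact mul_ne_zero h1 h2
  have ha' : a ≠ 0 := ha.ne'
  field_simp
  ring

/-- The partial-fraction identity behind the semialgebraicity of the auxiliary integrand
(`0 < a`, `0 < b < 1`): `4b/(a(1−b²)) = 2/(a(1−b)) − 2/(a(1+b))`. [folklore] -/
theorem dilogDup_partialFraction {a b : ℝ} (ha : 0 < a) (hb0 : 0 < b) (hb1 : b < 1) :
    4 * b / (a * (1 - b ^ 2)) = 2 * (1 / (a * (1 - b))) - 2 * (1 / (a * (1 + b))) := by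
  have h1 : (1 - b) ≠ 0 := by linarith
  have h2 : (1 + b) ≠ 0 := by linarith
  have h3 : (1 - b ^ 2) ≠ 0 := by
    rw [show (1 : ℝ) - b ^ 2 = (1 - b) * (1 + b) by ring]
    exact mul_ne_zero h1 h2
  have ha' : a ≠ 0 := ha.ne'
  field_simp
  ring

/-! ### The stub -/

/-- **STUB `stub_dilogDuplication`: THE DUPLICATION FORMULA `Li₂(x²) = 2 Li₂(x) + 2 Li₂(−x)`
INSIDE THE CALCULUS**, for real algebraic `0 < x < 1`: the squaring map `(a,b) ↦ (a²,b²)` carries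
the triangle `{0<b<a<x}` onto `{0<v<u<x²}` (Jacobian `4ab`; rule (2)) and pulls `du dv/(u(1−v))` back
to `4b/(a(1−b²)) = 2/(a(1−b)) − 2/(a(1+b))` (rule (1b)); `[{0<v<u<x}, 1/(u(1+v))]` has value
`−Li₂(−x)`. [cite: KontsevichZagier2001, §1.2] -/
theorem stub_dilogDuplication :
    ∀ (x : ℝ), IsAlgebraic ℚ x → 0 < x → x < 1 →
    ∀ (Lx2 Lx Mx : KZ.IntegralRep 2),
      Lx2.domain = {w | 0 < w 1 ∧ w 1 < w 0 ∧ w 0 < x ^ 2} →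
      Set.EqOn Lx2.integrand (fun w => 1 / (w 0 * (1 - w 1))) Lx2.domain →
      Lx.domain = {w | 0 < w 1 ∧ w 1 < w 0 ∧ w 0 < x} →
      Set.EqOn Lx.integrand (fun w => 1 / (w 0 * (1 - w 1))) Lx.domain →
      Mx.domain = {w | 0 < w 1 ∧ w 1 < w 0 ∧ w 0 < x} →
      Set.EqOn Mx.integrand (fun w => 1 / (w 0 * (1 + w 1))) Mx.domain →
      KZ.of Lx2 - 2 • KZ.of Lx + 2 • KZ.of Mx ∈ KZ.relations := by
  intro x _ hx0 hx1 Lx2 Lx Mx hLx2 hLx2i hLx hLxi hMx hMxi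
  -- the squaring map `Φ(a, b) = (a², b²)`
  set Φ : (Fin 2 → ℝ) → (Fin 2 → ℝ) := fun p => ![p 0 ^ 2, p 1 ^ 2] with hΦdef
  have hΦ : ∀ p, Φ p = ![p 0 ^ 2, p 1 ^ 2] := fun _ => rfl
  -- the triangle `T = {0 < b < a < x}` and the signs on it
  have hMxd : Mx.domain = Lx.domain := by rw [hMx, hLx]
  have hT : ∀ w ∈ Lx.domain, 0 < w 0 ∧ 0 < w 1 ∧ w 1 < 1 := fun w hw => by
    rw [hLx] at hw
    obtain ⟨h1, h2, h3⟩ := hw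
    exact ⟨h1.trans h2, h1, h2.trans (h3.trans hx1)⟩
  -- the auxiliary representation `R = [T, 2/(a(1−b)) − 2/(a(1+b))] = [T, 4b/(a(1−b²))]`
  have hRsa : IsSemialgebraicFunOn ℚ Lx.domain
      (fun w => 2 * Lx.integrand w - 2 * Mx.integrand w) := by
    have hq : ∀ w ∈ Lx.domain, aeval w (X 0 * (1 - X 1 ^ 2) : MvPolynomial (Fin 2) ℚ) ≠ 0 := by
      intro w hw
      obtain ⟨h0, h1, h2⟩ := hT w hw
      have h3 : (0 : ℝ) < 1 - w 1 ^ 2 := by nlinarith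
      simpa using (mul_pos h0 h3).ne'
    refine (isSemialgebraicFunOn_aeval_div_aeval Lx.isSemialgebraic_domain (4 * X 1)
      (X 0 * (1 - X 1 ^ 2)) hq).congr fun w hw => ?_
    obtain ⟨h0, h1, h2⟩ := hT w hw
    have e1 : Lx.integrand w = 1 / (w 0 * (1 - w 1)) := hLxi hw
    have e2 : Mx.integrand w = 1 / (w 0 * (1 + w 1)) := hMxi (hMxd.symm ▸ hw)
    rw [e1, e2, ← dilogDup_partialFraction h0 h1 h2]
    simp
  have hMint : IntegrableOn Mx.integrand Lx.domain := hMxd ▸ Mx.integrableOn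
  have hRint : IntegrableOn (fun w => 2 * Lx.integrand w - 2 * Mx.integrand w) Lx.domain :=
    (Integrable.const_mul Lx.integrableOn 2).sub (Integrable.const_mul hMint 2)
  obtain ⟨R, hRd, hRi⟩ : ∃ R : KZ.IntegralRep 2, R.domain = Lx.domain ∧
      R.integrand = fun w => 2 * Lx.integrand w - 2 * Mx.integrand w :=
    ⟨⟨Lx.domain, _, Lx.isSemialgebraic_domain, hRsa, hRint⟩, rfl, rfl⟩
  -- the data of the move
  have hΦsa : IsSemialgebraicMapOn ℚ R.domain Φ :=
    dilogDup_sqMap_isSemialgebraicMapOn Φ hΦ R.isSemialgebraic_domain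
  have hinj : InjOn Φ R.domain := by
    rw [hRd, hLx]
    exact dilogDup_sqMap_injOn Φ hΦ x
  have himage : Lx2.domain = Φ '' R.domain := by
    rw [hRd, hLx, hLx2, dilogDup_sqMap_image Φ hΦ hx0]
  choose Φ' hΦ' using dilogDup_sqMap_hasFDerivAt_det Φ hΦ
  -- rule (2): `[R] − [Lx2]` is one change-of-variables move
  have hRL : KZ.of R - KZ.of Lx2 ∈ KZ.relations := by
    refine KZ.changeOfVariablesRel_subset_relations
      ⟨2, R, Lx2, Φ, Φ', hΦsa, fun w _ => (hΦ' w).1.hasFDerivWithinAt, hinj, himage,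
        fun w hw => ?_, rfl⟩
    have hΦw : Φ w ∈ Lx2.domain := by
      rw [himage]
      exact mem_image_of_mem Φ hw
    rw [hRd] at hw
    obtain ⟨h0, h1, h2⟩ := hT w hw
    have e1 : Lx.integrand w = 1 / (w 0 * (1 - w 1)) := hLxi hw
    have e2 : Mx.integrand w = 1 / (w 0 * (1 + w 1)) := hMxi (hMxd.symm ▸ hw)
    have e3 : Lx2.integrand (Φ w) = 1 / (Φ w 0 * (1 - Φ w 1)) := hLx2i hΦw
    rw [(dilogDup_sqMap_apply Φ hΦ w).1, (dilogDup_sqMap_apply Φ hΦ w).2] at e3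
    rw [hRi]
    dsimp only
    rw [e1, e2, e3, (hΦ' w).2, abs_of_pos (mul_pos (mul_pos four_pos h0) h1)]
    exact dilogDup_jacobian_identity h0 h1 h2
  -- rule (1b): `[T, 2·Lx] − [R] − [T, 2·Mx]` is one integrand-additivity move, and
  -- `[T, 2 f] − 2•[T, f]` is integrand additivity
  have hL2 := KZ.IntegralRep.of_constMul_nat_sub_nsmul_mem_relations Lx 2
  have hM2 := KZ.IntegralRep.of_constMul_nat_sub_nsmul_mem_relations Mx 2
  have hadd : KZ.of (Lx.constMul ((2 : ℕ) : ℝ) (isAlgebraic_nat 2)) - KZ.of R -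
      KZ.of (Mx.constMul ((2 : ℕ) : ℝ) (isAlgebraic_nat 2)) ∈ KZ.relations :=
    KZ.integrandAddRel_subset_relations
      ⟨2, Lx.constMul ((2 : ℕ) : ℝ) (isAlgebraic_nat 2), R,
        Mx.constMul ((2 : ℕ) : ℝ) (isAlgebraic_nat 2), hRd, hMxd, fun w _ => by simp [hRi], rfl⟩
  -- assemble
  have hsum : KZ.of Lx2 - 2 • KZ.of Lx + 2 • KZ.of Mx =
      (KZ.of (Lx.constMul ((2 : ℕ) : ℝ) (isAlgebraic_nat 2)) - 2 • KZ.of Lx)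
        - (KZ.of (Mx.constMul ((2 : ℕ) : ℝ) (isAlgebraic_nat 2)) - 2 • KZ.of Mx)
        - (KZ.of R - KZ.of Lx2)
        - (KZ.of (Lx.constMul ((2 : ℕ) : ℝ) (isAlgebraic_nat 2)) - KZ.of R -
            KZ.of (Mx.constMul ((2 : ℕ) : ℝ) (isAlgebraic_nat 2))) := by
    abel
  rw [hsum]
  exact KZ.relations.sub_mem (KZ.relations.sub_mem (KZ.relations.sub_mem hL2 hM2) hRL) hadd

end Summit.KontsevichZagierPeriods.HyperbolicBloch.OffTetraSectorKernel

end
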